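import Literature.IUT.HodgeTheaters.PuncturedEllipticCoveringsCores
import Literature.IUT.HodgeTheaters.PuncturedEllipticCoveringsCuspTransport
import HarnessLib

/-!
# [IUTchI] Corollary 1.2 assembled from its printed anabelian inputs — proof-only

Mochizuki, *Inter-universal Teichmüller theory I*, kurims manuscript (May 2020), §1, Corollary 1.2
"Characteristic Nature of Coverings", statement and PROOF p. 39 ([IUTchI] Cor 1.2 p.39)
[claim: Mochizuki2012, status: disputed].  Node `IUTchI:Cor1.2`; proof-only companion (no definitions,
nothing restated) over abc-iut-L5-t1's FROZEN `PuncturedEllipticCoverings.lean` + `…Cusps.lean`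
(`CuspGalois`) + `…CuspsProofs.lean`, and the abc-iut-L5-d4 kernels `…Characteristic` (p405757),
`…Cores` (p407653), `…CuspRecovery` (p424465), `…Splitting` (p425983), `…XbarRecovery` (p429979),
`…CuspTransport` (cusp correspondence, `Θ(Π_C̲) = Π'_C̲`).

WHAT THIS FILE DOES.  The earlier assemblies (`characteristicNatureOfCoverings_of_core_extensions`,
`…_of_core_isos`) took as hypotheses an extension of the given isomorphism to `Π_C̲` (resp. to `Π_C`
plus Remark 1.2.1) ALREADY respecting the cusp classes — i.e. most of the conclusion.  Here the
non-resp'd clause of the typed Corollary 1.2 (`CharacteristicNatureOfCoverings.ofXarrow`: every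
bicontinuous `φ : Π_{X̲→} ⥲ Π'_{X̲→}` extends to `Φ : Π_C̲ ⥲ Π'_C̲` carrying `Π_X̲`, `Π_{C̲→}` and the
classes of the decomposition groups of `{ε′, ε″}`, `{ε̲}` to their counterparts) is DERIVED along the
printed route from hypotheses of EXACTLY the shape of the printed anabelian inputs, never asserted:
* (core) "`Π_{X̲→}, Π_X̲, Π_C` are slim [[AbsTopI] Prop. 2.3 (ii)] … one may recover `Δ_{X̲→} ⊆ Π_{X̲→}`
  [[AbsTopI] Thm. 2.6 (v)(vi)] … the algorithms of [AbsTopII] Cor. 3.3 (i), (ii) [applicable in light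
  of [AbsTopI] Ex. 4.8] allow one to reconstruct `Π_C` [together with `Π_{X̲→} ↪ Π_C`], as well as the
  subgroups `Δ_X ⊆ Δ_C ⊆ Π_C`" — hypothesis `hcore`: every bicontinuous `φ` extends to a bicontinuous
  `Θ : Π_C ⥲ Π'_C` with `Θ(Δ_X) = Δ'_X`, `Θ(Δ_C) = Δ'_C`;
* (cusps) "decomposition groups of cusps [cf. [AbsTopI] Lem. 4.5, as well as Rmk. 1.2.2 (ii)]" are
  group-theoretic in `Π_X̲` — hypothesis `hLem45`: every bicontinuous `Θ : Π_C ⥲ Π'_C` with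
  `Θ(Π_X̲) = Π'_X̲` carries the `Π_X̲`-conjugacy classes of the cuspidal decomposition groups of `X̲`
  onto those of `X̲'` (both directions);
* (ram) "the decomposition groups of `ε⁰, ε′, ε″` … whose image in `Gal(X̲→/X̲) = Π_X̲/Π_{X̲→}` is
  nontrivial": the clause for `ε⁰` — `¬ I_{ε⁰} ⊆ Π_{X̲→}` — is PRINTED (p. 39) but not among the frozen
  `ArrowCoveringClaims` (which give it for `ε′, ε″`, abc-iut-L5-d4 `not_inertia_le_piXarrow_iff`); it
  enters as the binder `h0` (resp. `h0'`), no new `Prop` is defined;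
* the printed claims of p. 38 (`ArrowCoveringClaims`), the cusp action (`CuspGalois`) and the law
  `[Π_X : Π_X̲] = l` ([IUTchI] Def. 3.1 (d); abc-iut-L5-t2 `ThetaGeometry.PiXbar_relIndex`), both sides.
CHAIN (all kernels): `Θ(Π_{X̲→}) = Π'_{X̲→}` ⇒ `l = l'` ⇒ `Θ(Π_X̲) = Π'_X̲` (`Π_X̲ = Π_{X̲→}·H`) ⇒
`Θ(Π_X) = Π'_X` ⇒ the cusp correspondence is functional, injective and intertwines the cusp actions and
the ramification criterion (`…CuspTransport`) ⇒ `Θ(Π_C̲) = Π'_C̲` (`map_piCbar_eq_of_cusps`) ⇒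
`ε⁰ ↦ ε⁰'` (the `Π_C̲`-fixed ramified cusp: `eq_ε0_of_map_decomp_ε0`), `{ε′, ε″} ↦ {ε′', ε″'}` ⇒ the
classes `cuspClassX`, `cuspClassC` pushed into `Π_C` correspond (`image_cuspClassX_eq`,
`image_cuspClassC_eq`) ⇒ restrict `Θ` to `Φ : Π_C̲ ⥲ Π'_C̲` (`…Cores`) and read off `Φ(Π_X̲)`,
`Φ(Π_{C̲→})` (`…Characteristic`).  Main results: `ofXarrow_of_anabelian`,
`characteristicNatureOfCoverings_of_anabelian` (the resp'd clause `ofCarrow` — "entirely similar [but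
slightly easier]" in print — keeps the hypothesis shape of `…Characteristic`, not re-derived here).
No side is taken on [IUTchIII] Cor. 3.12; typed ≠ discharged for the anabelian inputs.
-/

namespace Literature.IUT.HodgeTheaters

namespace PuncturedEllipticData

open scoped Pointwise
open Literature.AnabelianGeometry.AbsoluteAnabelian

universe u

variable {D D' : PuncturedEllipticData.{u}}

/-! ### `ε⁰ ↦ ε⁰'` and `{ε′, ε″} ↦ {ε′', ε″'}` -/

section CuspLabels

variable (h : D.ArrowCoveringClaims) (h' : D'.ArrowCoveringClaims) (C : D.CuspGalois)
  (C' : D'.CuspGalois) (Θ : D.PiC ≃* D'.PiC) (hΘ : D.piXarrow.map Θ.toMonoidHom = D'.piXarrow)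
  (hΘΔ : D.DeltaC.map Θ.toMonoidHom = D'.DeltaC) (hΘXbar : D.PiXbar.map Θ.toMonoidHom = D'.PiXbar)
  (hΘCbar : D.PiCbar.map Θ.toMonoidHom = D'.PiCbar) (h0 : ¬ D.inertia D.ε0 ≤ D.piXarrow)
  (h0' : ¬ D'.inertia D'.ε0 ≤ D'.piXarrow)
  (hcusp : ∀ x : D.Cusp, ∃ x' : D'.Cusp, ∃ t' ∈ D'.PiXbar,
    (D.decomp x).map Θ.toMonoidHom = MulAut.conj t' • D'.decomp x')
  (hcusp' : ∀ x' : D'.Cusp, ∃ x : D.Cusp, ∃ t' ∈ D'.PiXbar,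
    (D.decomp x).map Θ.toMonoidHom = MulAut.conj t' • D'.decomp x')

include h h' C C' hΘ hΘΔ hΘXbar hΘCbar h0 h0' in
/-- **`ε⁰ ↦ ε⁰'`**: the cusp corresponding to `ε⁰` is fixed by `Π'_C̲ = Θ(Π_C̲)` (as `ε⁰` is by `Π_C̲`)
and ramified, hence is `ε⁰'` (`ι̲'` switches `ε′', ε″'`). ([IUTchI] Cor 1.2 p.39)
[claim: Mochizuki2012, status: disputed] -/
theorem eq_ε0_of_map_decomp_ε0 {x' : D'.Cusp} {t' : D'.PiC} (ht' : t' ∈ D'.PiXbar)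
    (hx : (D.decomp D.ε0).map Θ.toMonoidHom = MulAut.conj t' • D'.decomp x') : x' = D'.ε0 := by
  obtain ⟨c', hc', hc'X⟩ := h'.exists_mem_piCbar_not_mem_piX
  have hc'mem : c' ∈ D.PiCbar.map Θ.toMonoidHom := by rw [hΘCbar]; exact hc'
  obtain ⟨c, hc, rfl⟩ := hc'mem
  obtain ⟨t'', ht'', hact⟩ := map_decomp_act C C' Θ hΘXbar ht' hx c
  rw [C.act_ε0 c hc] at hact
  have hfix : C'.act (Θ c) x' = x' := cusp_eq_of_map_decomp_eq C' Θ ht'' ht' hact hx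
  have hx'T : x' ∈ ({D'.ε0, D'.ε1, D'.ε2} : Set D'.Cusp) :=
    (mem_triple_iff_of_map_decomp h h' Θ hΘ hΘΔ h0 h0' ht' hx).mp (by simp)
  simp only [Set.mem_insert_iff, Set.mem_singleton_iff] at hx'T
  rcases hx'T with h0e | h1e | h2e
  · exact h0e
  · exact absurd ((h1e ▸ hfix).symm.trans (C'.act_ε1 _ hc' hc'X)) D'.ε1_ne_ε2
  · exact absurd ((h2e ▸ hfix).symm.trans (C'.act_ε2 hc' hc'X)) D'.ε1_ne_ε2.symm

include h h' C C' hΘ hΘΔ hΘXbar hΘCbar h0 h0' hcusp in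
/-- **`{ε′, ε″} ↦ {ε′', ε″'}`** (forward): a cusp corresponding to `ε′` or `ε″` is `ε′'` or `ε″'`.
([IUTchI] Cor 1.2 p.39) [claim: Mochizuki2012, status: disputed] -/
theorem eq_ε1_or_eq_ε2_of_map_decomp {e : D.Cusp} (he : e = D.ε1 ∨ e = D.ε2) {e' : D'.Cusp}
    {t' : D'.PiC} (ht' : t' ∈ D'.PiXbar)
    (hee' : (D.decomp e).map Θ.toMonoidHom = MulAut.conj t' • D'.decomp e') :
    e' = D'.ε1 ∨ e' = D'.ε2 := by
  have heT : e ∈ ({D.ε0, D.ε1, D.ε2} : Set D.Cusp) := by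
    rcases he with rfl | rfl <;> simp
  have he'T := (mem_triple_iff_of_map_decomp h h' Θ hΘ hΘΔ h0 h0' ht' hee').mp heT
  have hne : e' ≠ D'.ε0 := by
    rintro rfl
    obtain ⟨y', s', hs', hy'⟩ := hcusp D.ε0
    have hy'0 : y' = D'.ε0 :=
      eq_ε0_of_map_decomp_ε0 h h' C C' Θ hΘ hΘΔ hΘXbar hΘCbar h0 h0' hs' hy'
    subst hy'0
    have : e = D.ε0 := cusp_eq_of_map_decomp_eq' C Θ hΘXbar ht' hs' hee' hy'
    rcases he with rfl | rfl
    · exact D.ε1_ne_ε0 this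
    · exact D.ε2_ne_ε0 this
  simp only [Set.mem_insert_iff, Set.mem_singleton_iff] at he'T
  rcases he'T with h0e | h1e | h2e
  · exact absurd h0e hne
  · exact Or.inl h1e
  · exact Or.inr h2e

include h h' C C' hΘ hΘΔ hΘXbar hΘCbar h0 h0' hcusp' in
/-- **`{ε′, ε″} ↦ {ε′', ε″'}`** (backward): `ε′'`, `ε″'` correspond to `ε′` or `ε″`.
([IUTchI] Cor 1.2 p.39) [claim: Mochizuki2012, status: disputed] -/
theorem exists_map_decomp_of_eq_ε1_or_eq_ε2 {e' : D'.Cusp} (he' : e' = D'.ε1 ∨ e' = D'.ε2) :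
    ∃ e : D.Cusp, (e = D.ε1 ∨ e = D.ε2) ∧ ∃ t' ∈ D'.PiXbar,
      (D.decomp e).map Θ.toMonoidHom = MulAut.conj t' • D'.decomp e' := by
  obtain ⟨e, t', ht', hee'⟩ := hcusp' e'
  have he'T : e' ∈ ({D'.ε0, D'.ε1, D'.ε2} : Set D'.Cusp) := by
    rcases he' with rfl | rfl <;> simp
  have heT := (mem_triple_iff_of_map_decomp h h' Θ hΘ hΘΔ h0 h0' ht' hee').mpr he'T
  have hne : e ≠ D.ε0 := by
    rintro rfl
    have : e' = D'.ε0 := eq_ε0_of_map_decomp_ε0 h h' C C' Θ hΘ hΘΔ hΘXbar hΘCbar h0 h0' ht' hee'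
    rcases he' with rfl | rfl
    · exact D'.ε1_ne_ε0 this
    · exact D'.ε2_ne_ε0 this
  refine ⟨e, ?_, t', ht', hee'⟩
  simp only [Set.mem_insert_iff, Set.mem_singleton_iff] at heT
  rcases heT with h0e | h1e | h2e
  · exact absurd h0e hne
  · exact Or.inl h1e
  · exact Or.inr h2e

end CuspLabels

/-! ### The classes `cuspClassX`, `cuspClassC` pushed into `Π_C`, and their transport -/

/-- `cuspClassX` pushed into `Π_C`: the `Π_X̲`-conjugates of `D_{ε′}`, `D_{ε″}`. ([IUTchI] Cor 1.2 p.39)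
[claim: Mochizuki2012, status: disputed] -/
theorem image_map_subtype_cuspClassX (D : PuncturedEllipticData.{u}) :
    (fun K : Subgroup D.PiCbar => K.map D.PiCbar.subtype) '' D.cuspClassX =
      {L | ∃ t ∈ D.PiXbar, ∃ e : D.Cusp, (e = D.ε1 ∨ e = D.ε2) ∧ L = MulAut.conj t • D.decomp e} := by
  ext L
  simp only [Set.mem_image, cuspClassX, Set.mem_setOf_eq]
  constructor
  · rintro ⟨K, ⟨t, ht, e, he, rfl⟩, rfl⟩
    exact ⟨(t : D.PiC), ht, e, he,
      map_subtype_conj_smul_subgroupOf t (fun _ hz => (D.decomp_le e hz).2)⟩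
  · rintro ⟨t, ht, e, he, rfl⟩
    exact ⟨MulAut.conj (⟨t, D.piXbar_le_piCbar ht⟩ : D.PiCbar) • (D.decomp e).subgroupOf D.PiCbar,
      ⟨⟨t, D.piXbar_le_piCbar ht⟩, ht, e, he, rfl⟩,
      map_subtype_conj_smul_subgroupOf _ (fun _ hz => (D.decomp_le e hz).2)⟩

/-- `cuspClassC` pushed into `Π_C`: the `Π_C̲`-conjugates of `D_{ε′}`. ([IUTchI] Cor 1.2 p.39)
[claim: Mochizuki2012, status: disputed] -/
theorem image_map_subtype_cuspClassC (D : PuncturedEllipticData.{u}) :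
    (fun K : Subgroup D.PiCbar => K.map D.PiCbar.subtype) '' D.cuspClassC =
      {L | ∃ t ∈ D.PiCbar, L = MulAut.conj t • D.decomp D.ε1} := by
  ext L
  simp only [Set.mem_image, cuspClassC, Set.mem_setOf_eq]
  constructor
  · rintro ⟨K, ⟨t, rfl⟩, rfl⟩
    exact ⟨(t : D.PiC), t.2, map_subtype_conj_smul_subgroupOf t (fun _ hz => (D.decomp_le _ hz).2)⟩
  · rintro ⟨t, ht, rfl⟩
    exact ⟨MulAut.conj (⟨t, ht⟩ : D.PiCbar) • (D.decomp D.ε1).subgroupOf D.PiCbar, ⟨⟨t, ht⟩, rfl⟩,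
      map_subtype_conj_smul_subgroupOf _ (fun _ hz => (D.decomp_le _ hz).2)⟩

/-- `D_{ε′}`, `D_{ε″}` are `Π_C̲`-conjugate (`ι̲ ε′ = ε″`): the decomposition group of either cusp over
`ε̲` is a `Π_C̲`-conjugate of `D_{ε′}`. ([IUTchI] Cor 1.2 p.39) [claim: Mochizuki2012, status: disputed] -/
theorem ArrowCoveringClaims.exists_decomp_eq_conj_decomp_ε1 (h : D.ArrowCoveringClaims)
    (C : D.CuspGalois) {e : D.Cusp} (he : e = D.ε1 ∨ e = D.ε2) :
    ∃ q ∈ D.PiCbar, D.decomp e = MulAut.conj q • D.decomp D.ε1 := by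
  rcases he with rfl | rfl
  · exact ⟨1, D.PiCbar.one_mem, by rw [map_one, one_smul]⟩
  · obtain ⟨c, hc, hcX⟩ := h.exists_mem_piCbar_not_mem_piX
    obtain ⟨t, ht, hconj⟩ := C.act_decomp c D.ε1
    rw [C.act_ε1 c hc hcX] at hconj
    exact ⟨t * c, D.PiCbar.mul_mem (D.piXbar_le_piCbar ht) hc, hconj.symm⟩

section Transport

variable (h : D.ArrowCoveringClaims) (h' : D'.ArrowCoveringClaims) (C : D.CuspGalois)
  (C' : D'.CuspGalois) (Θ : D.PiC ≃* D'.PiC) (hΘ : D.piXarrow.map Θ.toMonoidHom = D'.piXarrow)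
  (hΘΔ : D.DeltaC.map Θ.toMonoidHom = D'.DeltaC) (hΘXbar : D.PiXbar.map Θ.toMonoidHom = D'.PiXbar)
  (hΘCbar : D.PiCbar.map Θ.toMonoidHom = D'.PiCbar) (h0 : ¬ D.inertia D.ε0 ≤ D.piXarrow)
  (h0' : ¬ D'.inertia D'.ε0 ≤ D'.piXarrow)
  (hcusp : ∀ x : D.Cusp, ∃ x' : D'.Cusp, ∃ t' ∈ D'.PiXbar,
    (D.decomp x).map Θ.toMonoidHom = MulAut.conj t' • D'.decomp x')
  (hcusp' : ∀ x' : D'.Cusp, ∃ x : D.Cusp, ∃ t' ∈ D'.PiXbar,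
    (D.decomp x).map Θ.toMonoidHom = MulAut.conj t' • D'.decomp x')

include h h' C C' hΘ hΘΔ hΘXbar hΘCbar h0 h0' hcusp hcusp' in
/-- **Transport of the class of `{ε′, ε″}`** (pushed into `Π_C`): `Θ` carries the `Π_X̲`-conjugates of
`D_{ε′}, D_{ε″}` onto the `Π'_X̲`-conjugates of `D'_{ε′'}, D'_{ε″'}`. ([IUTchI] Cor 1.2 p.39)
[claim: Mochizuki2012, status: disputed] -/
theorem image_cuspClassX_eq :
    (fun K : Subgroup D.PiCbar => (K.map D.PiCbar.subtype).map Θ.toMonoidHom) '' D.cuspClassX =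
      (fun K' : Subgroup D'.PiCbar => K'.map D'.PiCbar.subtype) '' D'.cuspClassX := by
  rw [show (fun K : Subgroup D.PiCbar => (K.map D.PiCbar.subtype).map Θ.toMonoidHom) =
      (fun L => L.map Θ.toMonoidHom) ∘ (fun K => K.map D.PiCbar.subtype) from rfl, Set.image_comp,
    image_map_subtype_cuspClassX, image_map_subtype_cuspClassX]
  ext L'
  simp only [Set.mem_image, Set.mem_setOf_eq]
  constructor
  · rintro ⟨L, ⟨t, ht, e, he, rfl⟩, rfl⟩
    obtain ⟨e', t', ht', hee'⟩ := hcusp e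
    have he' := eq_ε1_or_eq_ε2_of_map_decomp h h' C C' Θ hΘ hΘΔ hΘXbar hΘCbar h0 h0' hcusp he
      ht' hee'
    have hΘt : Θ.toMonoidHom t ∈ D'.PiXbar := by rw [← hΘXbar]; exact ⟨t, ht, rfl⟩
    refine ⟨Θ.toMonoidHom t * t', D'.PiXbar.mul_mem hΘt ht', e', he', ?_⟩
    rw [map_conj_smul, hee', ← mul_smul, ← map_mul]
  · rintro ⟨t', ht', e', he', rfl⟩
    obtain ⟨e, he, t'', ht'', hee'⟩ :=
      exists_map_decomp_of_eq_ε1_or_eq_ε2 h h' C C' Θ hΘ hΘΔ hΘXbar hΘCbar h0 h0' hcusp' he'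
    have hmem : t' * t''⁻¹ ∈ D.PiXbar.map Θ.toMonoidHom := by
      rw [hΘXbar]; exact D'.PiXbar.mul_mem ht' (D'.PiXbar.inv_mem ht'')
    obtain ⟨s, hs, hst⟩ := hmem
    refine ⟨MulAut.conj s • D.decomp e, ⟨s, hs, e, he, rfl⟩, ?_⟩
    rw [map_conj_smul, hee', ← mul_smul, ← map_mul, hst, inv_mul_cancel_right]

include h h' C C' hΘ hΘΔ hΘXbar hΘCbar h0 h0' hcusp in
/-- **Transport of the class of `ε̲`** (pushed into `Π_C`): `Θ` carries the `Π_C̲`-conjugates of `D_{ε′}`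
onto the `Π'_C̲`-conjugates of `D'_{ε′'}`. ([IUTchI] Cor 1.2 p.39) [claim: Mochizuki2012, status: disputed] -/
theorem image_cuspClassC_eq :
    (fun K : Subgroup D.PiCbar => (K.map D.PiCbar.subtype).map Θ.toMonoidHom) '' D.cuspClassC =
      (fun K' : Subgroup D'.PiCbar => K'.map D'.PiCbar.subtype) '' D'.cuspClassC := by
  rw [show (fun K : Subgroup D.PiCbar => (K.map D.PiCbar.subtype).map Θ.toMonoidHom) =
      (fun L => L.map Θ.toMonoidHom) ∘ (fun K => K.map D.PiCbar.subtype) from rfl, Set.image_comp,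
    image_map_subtype_cuspClassC, image_map_subtype_cuspClassC]
  -- `Θ(D_{ε′}) = (t₁ q) • D'_{ε′'}` with `t₁ q ∈ Π'_C̲`
  obtain ⟨e₁, t₁, ht₁, he₁⟩ := hcusp D.ε1
  have he₁' := eq_ε1_or_eq_ε2_of_map_decomp h h' C C' Θ hΘ hΘΔ hΘXbar hΘCbar h0 h0' hcusp
    (Or.inl rfl) ht₁ he₁
  obtain ⟨q, hq, hq'⟩ := h'.exists_decomp_eq_conj_decomp_ε1 C' he₁'
  rw [hq', ← mul_smul, ← map_mul] at he₁
  have hr : t₁ * q ∈ D'.PiCbar := D'.PiCbar.mul_mem (D'.piXbar_le_piCbar ht₁) hq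
  ext L'
  simp only [Set.mem_image, Set.mem_setOf_eq]
  constructor
  · rintro ⟨L, ⟨t, ht, rfl⟩, rfl⟩
    have hΘt : Θ.toMonoidHom t ∈ D'.PiCbar := by rw [← hΘCbar]; exact ⟨t, ht, rfl⟩
    refine ⟨Θ.toMonoidHom t * (t₁ * q), D'.PiCbar.mul_mem hΘt hr, ?_⟩
    rw [map_conj_smul, he₁, ← mul_smul, ← map_mul]
  · rintro ⟨t', ht', rfl⟩
    have hmem : t' * (t₁ * q)⁻¹ ∈ D.PiCbar.map Θ.toMonoidHom := by
      rw [hΘCbar]; exact D'.PiCbar.mul_mem ht' (D'.PiCbar.inv_mem hr)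
    obtain ⟨s, hs, hst⟩ := hmem
    refine ⟨MulAut.conj s • D.decomp D.ε1, ⟨s, hs, rfl⟩, ?_⟩
    rw [map_conj_smul, he₁, ← mul_smul, ← map_mul, hst, inv_mul_cancel_right]

end Transport

/-! ### Corollary 1.2, non-resp'd clause, from the printed anabelian inputs -/

/-- **Corollary 1.2 (Characteristic Nature of Coverings), non-resp'd clause, ASSEMBLED along the
printed route.**  For data `D, D'` satisfying the printed claims of p. 38 (`ArrowCoveringClaims`),
with cusp actions (`CuspGalois`), the law `[Π_X : Π_X̲] = l` and the printed ramification of `ε⁰`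
(`¬ I_{ε⁰} ⊆ Π_{X̲→}`), and GIVEN — as hypotheses, never asserted — the anabelian inputs of the proof
(p. 39): `hcore` (slimness + [AbsTopI] Thm. 2.6 (v)(vi) + [AbsTopII] Cor. 3.3 (i)(ii): every
bicontinuous `φ : Π_{X̲→} ⥲ Π'_{X̲→}` extends to a bicontinuous `Θ : Π_C ⥲ Π'_C` with `Θ(Δ_X) = Δ'_X`,
`Θ(Δ_C) = Δ'_C`) and `hLem45` ([AbsTopI] Lem. 4.5 with Rmk. 1.2.2 (ii): such `Θ` with
`Θ(Π_X̲) = Π'_X̲` induce a correspondence of the cuspidal decomposition groups of `X̲`, `X̲'` up to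
`Π_X̲`-conjugacy) — every bicontinuous `φ` extends to a continuous `Φ : Π_C̲ ⥲ Π'_C̲` carrying the
classes of the decomposition groups of `{ε′, ε″}` and of `ε̲` onto their counterparts.
([IUTchI] Cor 1.2 p.39) [claim: Mochizuki2012, status: disputed] -/
theorem ofXarrow_of_anabelian (h : D.ArrowCoveringClaims) (h' : D'.ArrowCoveringClaims)
    (C : D.CuspGalois) (C' : D'.CuspGalois) (hX : D.PiXbar.relIndex D.PiX = D.l)
    (hX' : D'.PiXbar.relIndex D'.PiX = D'.l) (h0 : ¬ D.inertia D.ε0 ≤ D.piXarrow)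
    (h0' : ¬ D'.inertia D'.ε0 ≤ D'.piXarrow)
    (hcore : ∀ φ : D.piXarrow ≃* D'.piXarrow, Continuous φ → Continuous φ.symm →
      ∃ Θ : D.PiC ≃* D'.PiC, Continuous Θ ∧ Continuous Θ.symm ∧
        (∀ x : D.piXarrow, Θ (x : D.PiC) = (φ x : D'.PiC)) ∧
        (D.PiX ⊓ D.DeltaC).map Θ.toMonoidHom = D'.PiX ⊓ D'.DeltaC ∧
        D.DeltaC.map Θ.toMonoidHom = D'.DeltaC)
    (hLem45 : ∀ Θ : D.PiC ≃* D'.PiC, Continuous Θ → Continuous Θ.symm →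
      D.PiXbar.map Θ.toMonoidHom = D'.PiXbar →
        (∀ x : D.Cusp, ∃ x' : D'.Cusp, ∃ t' ∈ D'.PiXbar,
          (D.decomp x).map Θ.toMonoidHom = MulAut.conj t' • D'.decomp x') ∧
        (∀ x' : D'.Cusp, ∃ x : D.Cusp, ∃ t' ∈ D'.PiXbar,
          (D.decomp x).map Θ.toMonoidHom = MulAut.conj t' • D'.decomp x')) :
    ∀ φ : D.piXarrow ≃* D'.piXarrow, Continuous φ → Continuous φ.symm →
      ∃ Φ : D.PiCbar ≃* D'.PiCbar, Continuous Φ ∧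
        (∀ (x : D.PiC) (hx : x ∈ D.piXarrow) (hx' : x ∈ D.PiCbar),
          (Φ ⟨x, hx'⟩ : D'.PiC) = (φ ⟨x, hx⟩ : D'.PiC)) ∧
        Subgroup.map Φ.toMonoidHom '' D.cuspClassX = D'.cuspClassX ∧
        Subgroup.map Φ.toMonoidHom '' D.cuspClassC = D'.cuspClassC := by
  intro φ hφ hφ'
  obtain ⟨Θ, hc, hc', hext, hΘX, hΘΔ⟩ := hcore φ hφ hφ'
  have hΘ : D.piXarrow.map Θ.toMonoidHom = D'.piXarrow := map_eq_of_extends φ Θ hext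
  have hΘXbar : D.PiXbar.map Θ.toMonoidHom = D'.PiXbar :=
    h.map_piXbar_eq_of_map_deltaX h' C C' hX hX' Θ hc hc' hΘ hΘX hΘΔ
  obtain ⟨hcusp, hcusp'⟩ := hLem45 Θ hc hc' hΘXbar
  have hΘCbar : D.PiCbar.map Θ.toMonoidHom = D'.PiCbar :=
    h.map_piCbar_eq_of_cusps h' C C' hX hX' h0 h0' Θ hc hc' hΘ hΘX hΘΔ hcusp'
  obtain ⟨Φ, hΦc, hΦ⟩ := exists_continuous_restrict_piCbar Θ hc hΘCbar
  refine ⟨Φ, hΦc, fun x hx hx' => ?_,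
    image_map_subtype_transport Θ Φ hΦ _ _
      (image_cuspClassX_eq h h' C C' Θ hΘ hΘΔ hΘXbar hΘCbar h0 h0' hcusp hcusp'),
    image_map_subtype_transport Θ Φ hΦ _ _
      (image_cuspClassC_eq h h' C C' Θ hΘ hΘΔ hΘXbar hΘCbar h0 h0' hcusp)⟩
  rw [hΦ ⟨x, hx'⟩]
  exact hext ⟨x, hx⟩

/-- **Corollary 1.2 from the printed anabelian inputs** (non-resp'd clause assembled as above; the
resp'd clause `Π_{C̲→}` — "entirely similar [but slightly easier]" — keeps the hypothesis shape of
`characteristicNatureOfCoverings_of_core_extensions`). ([IUTchI] Cor 1.2 p.39)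
[claim: Mochizuki2012, status: disputed] -/
theorem characteristicNatureOfCoverings_of_anabelian (h : D.ArrowCoveringClaims)
    (h' : D'.ArrowCoveringClaims) (C : D.CuspGalois) (C' : D'.CuspGalois)
    (hX : D.PiXbar.relIndex D.PiX = D.l) (hX' : D'.PiXbar.relIndex D'.PiX = D'.l)
    (h0 : ¬ D.inertia D.ε0 ≤ D.piXarrow) (h0' : ¬ D'.inertia D'.ε0 ≤ D'.piXarrow)
    (hcore : ∀ φ : D.piXarrow ≃* D'.piXarrow, Continuous φ → Continuous φ.symm →
      ∃ Θ : D.PiC ≃* D'.PiC, Continuous Θ ∧ Continuous Θ.symm ∧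
        (∀ x : D.piXarrow, Θ (x : D.PiC) = (φ x : D'.PiC)) ∧
        (D.PiX ⊓ D.DeltaC).map Θ.toMonoidHom = D'.PiX ⊓ D'.DeltaC ∧
        D.DeltaC.map Θ.toMonoidHom = D'.DeltaC)
    (hLem45 : ∀ Θ : D.PiC ≃* D'.PiC, Continuous Θ → Continuous Θ.symm →
      D.PiXbar.map Θ.toMonoidHom = D'.PiXbar →
        (∀ x : D.Cusp, ∃ x' : D'.Cusp, ∃ t' ∈ D'.PiXbar,
          (D.decomp x).map Θ.toMonoidHom = MulAut.conj t' • D'.decomp x') ∧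
        (∀ x' : D'.Cusp, ∃ x : D.Cusp, ∃ t' ∈ D'.PiXbar,
          (D.decomp x).map Θ.toMonoidHom = MulAut.conj t' • D'.decomp x'))
    (hC : ∀ ψ : D.piCarrow ≃* D'.piCarrow, Continuous ψ → Continuous ψ.symm →
      ∃ Ψ : D.PiCbar ≃* D'.PiCbar, Continuous Ψ ∧
        (∀ (x : D.PiC) (hx : x ∈ D.piCarrow) (hx' : x ∈ D.PiCbar),
          (Ψ ⟨x, hx'⟩ : D'.PiC) = (ψ ⟨x, hx⟩ : D'.PiC)) ∧
        Subgroup.map Ψ.toMonoidHom '' D.cuspClassC = D'.cuspClassC) :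
    D.CharacteristicNatureOfCoverings D' :=
  characteristicNatureOfCoverings_of_core_extensions h h'
    (ofXarrow_of_anabelian h h' C C' hX hX' h0 h0' hcore hLem45) hC

end PuncturedEllipticData

end Literature.IUT.HodgeTheaters
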